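import Summits.BirchSwinnertonDyer.BirchSwinnertonDyer.Theorems.KimAtThreeSemiLocalTraceDual
import HarnessLib

/-!
# Route `KimAtThreeKolyvagin` (W2), the deep leaf's UNIFORM road (clause X1-int): self-duality of the
# semi-local integer lattice in the RIDER's currency `cycIntLattice p m = ℤ_p⟨1 ⊗ ζ_m^j⟩`, and
# `cycIntLattice p m = L_int′(m)` for `p ∤ m`

Cell `bsd-addord`, seat `bsd-addord-w2-acc3` (PROGRAMME PART 1b row (3), gen 5); companion of
`KimAtThreeSemiLocalTraceDual` (same seat); `--supports stmt-BirchSwinnertonDyer-19679` (helper).  TOOL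
theorems only (no definition, no named fact, no `sorry`); nothing asserted about any curve; closes nothing.

WHY.  The W2 consumers state the rider clause (ii) / the crude compatibility (X1-int_b) of (C1ₑₓ)
(`KimAtThreeDeepLeafOfDefinedKatoUniform`, seat w2-c3 g7) with the lattice
`cycIntLattice p m = ℤ_p⟨(1 ⊗ ζ_m)^j⟩` of `GaloisImage.KatoExpStarFiniteLevel`, whereas the semi-local
isomorphism `Ψ` of seat w2-acc4 is proved to carry `L_int′(m) = ℤ_p⟨1 ⊗ 𝓞_{ℚ(ζ_m)}⟩` onto `∏_w 𝒪_w`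
(INTO + ONTO) and `cycIntLattice p m` only INTO it ("equality needs `𝓞 = ℤ[ζ_m]`, in Mathlib for prime
powers only" — `KimAtThreeFineKatoSemiLocalLatticeInt`).  The companion file's dual-basis argument is
already a `ℤ[ζ]`-statement (`m·ℤ[ζ]^∨ ⊆ ℤ[ζ]`), so it proves MORE: an element with `p`-integral traces
against the `1 ⊗ ζ^j` alone lies in `cycIntLattice p m` when `p ∤ m`.  Consequences: **`cycIntLattice p m
= L_int′(m) = Ψ⁻¹(∏_w 𝒪_w)` for `p ∤ m`** with NO global input on `𝓞_{ℚ(ζ_m)}`, and the per-factor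
crude bound lands directly in the consumers' lattice.

* `one_tmul_mem_cycIntLattice_of_mem_adjoin` — `1 ⊗ ℤ[ζ] ⊆ cycIntLattice`.
* `natCast_smul_mem_cycIntLattice_of_norm_trace_mul_zeta_pow_le_one` (any `m`): `‖Tr(a·(1 ⊗ ζ^j))‖ ≤ 1`
  for all `j` ⟹ `m·a ∈ cycIntLattice p m`.
* ★★ `mem_cycIntLattice_of_norm_trace_mul_zeta_pow_le_one` (`p ∤ m`): the same without the factor `m`.
* `cycIntLattice_eq_span_ringOfIntegers` (`p ∤ m`): `cycIntLattice p m = L_int′(m)`.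
* `mem_cycIntLattice_iff_forall_norm_trace_mul_le_one` (`p ∤ m`): `(cycIntLattice)^∨ = cycIntLattice`.
* `symm_mem_cycIntLattice_of_forall_trace_mul_mem` (`p ∤ m`): per-factor trace duals ⟹ `Ψ⁻¹ y ∈
  cycIntLattice p m`.
* (appended) `prime_smul_symm_mem_cycIntLattice_of_pairing` / `…_span_ringOfIntegers_of_pairing` — the
  uniform road's lattice clause (LAT₁) (acc5's (LAT), w2-c3's (LAT_b) at `b = 1`): per-factor log-lattices
  `Λ₀ʷ ⊇ p𝒪_w` (K-port) and `p`-integral pairing of `φ_w = exp*_ω` against `Λ₀ʷ` ((S5b) at `K = L_w`)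
  give `p·Ψ⁻¹((φ_w(z_w))_w) ∈ cycIntLattice p m`.

HONEST LIMITS: `p ∤ m` (tame Kolyvagin levels); at levels divisible by `p` neither lattice is self-dual.
References: [Kim2022StructureSelmer] §3.4.1 and the proof of Thm. 3.13; [CasselsFrohlichANT1967] II §10–§11;
J. Neukirch, *Algebraic Number Theory*, III (2.4) [folklore].
-/

set_option autoImplicit false
-- the Theorems namespace of a single-conjunct summit repeats the summit name by design (D-0017)
set_option linter.dupNamespace false
-- `CyclotomicField m ℚ`'s two `ℚ`-algebra structures agree only up to unfolding (as in the sibling files)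
set_option backward.isDefEq.respectTransparency false

noncomputable section

open scoped TensorProduct NumberField
open NumberField Polynomial IsDedekindDomain
open Summit.BirchSwinnertonDyer.Rank1Residual.GaloisImage
open Summit.BirchSwinnertonDyer.BirchSwinnertonDyer.Theorems.KimAtThreePortSharedSATCore
open Summit.BirchSwinnertonDyer.BirchSwinnertonDyer.Theorems.KimAtThreeSemiLocalTraceDual

namespace Summit.BirchSwinnertonDyer.BirchSwinnertonDyer.Theorems.KimAtThreeSemiLocalTraceDualCyc

variable (m : ℕ) [NeZero m] (p : ℕ) [Fact p.Prime]


/-- `1 ⊗ z ∈ cycIntLattice p m` for every `z ∈ ℤ[ζ_m]` (`ℤ[ζ]` is the `ℤ`-span of the powers `ζ^j`).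
[folklore] -/
theorem one_tmul_mem_cycIntLattice_of_mem_adjoin {z : CyclotomicField m ℚ}
    (hz : z ∈ Algebra.adjoin ℤ {IsCyclotomicExtension.zeta m ℚ (CyclotomicField m ℚ)}) :
    (1 : ℚ_[p]) ⊗ₜ[ℚ] z ∈ cycIntLattice p m := by
  rw [Algebra.adjoin_singleton_eq_range_aeval] at hz
  obtain ⟨P, rfl⟩ := hz
  induction P using Polynomial.induction_on' with
  | add P Q hP hQ =>
    rw [map_add, TensorProduct.tmul_add]
    exact Submodule.add_mem _ hP hQ
  | monomial n c =>
    change (1 : ℚ_[p]) ⊗ₜ[ℚ] (aeval (IsCyclotomicExtension.zeta m ℚ (CyclotomicField m ℚ))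
      (monomial n c)) ∈ cycIntLattice p m
    rw [aeval_monomial, algebraMap_int_eq, eq_intCast, ← zsmul_eq_mul]
    change TensorProduct.mk ℚ ℚ_[p] (CyclotomicField m ℚ) (1 : ℚ_[p]) (c • _) ∈ cycIntLattice p m
    rw [map_zsmul, TensorProduct.mk_apply]
    have hgen : ((1 : ℚ_[p]) ⊗ₜ[ℚ] IsCyclotomicExtension.zeta m ℚ (CyclotomicField m ℚ)) ^ n ∈
        cycIntLattice p m :=
      Submodule.subset_span (Set.mem_range_self n)
    rw [Algebra.TensorProduct.tmul_pow, one_pow] at hgen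
    exact zsmul_mem hgen c

/-- **`m·(cycIntLattice p m)^∨ ⊆ cycIntLattice p m`** (any `m`): if `a ∈ ℚ_p ⊗ ℚ(ζ_m)` has
`‖Tr(a·(1 ⊗ ζ^j))‖ ≤ 1` for every `j`, then `m·a ∈ cycIntLattice p m = ℤ_p⟨1 ⊗ ζ^j⟩` (dual-basis expansion
as in §3, now with `m·d_i ∈ ℤ[ζ]` read in `ℤ_p⟨1 ⊗ ζ^j⟩`).
[cite: Kim2022StructureSelmer, §3.4.1 (the lattice `ℤ_p ⊗ ℤ[ζ_n]` in the proof of Thm. 3.13)] -/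
theorem natCast_smul_mem_cycIntLattice_of_norm_trace_mul_zeta_pow_le_one
    {a : ℚ_[p] ⊗[ℚ] CyclotomicField m ℚ}
    (ha : ∀ j : ℕ, ‖Algebra.trace ℚ_[p] (ℚ_[p] ⊗[ℚ] CyclotomicField m ℚ)
        (a * ((1 : ℚ_[p]) ⊗ₜ[ℚ] (IsCyclotomicExtension.zeta m ℚ (CyclotomicField m ℚ) ^ j)))‖ ≤ 1) :
    (m : ℚ_[p]) • a ∈ cycIntLattice p m := by
  classical
  have hζ := IsCyclotomicExtension.zeta_spec m ℚ (CyclotomicField m ℚ)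
  set ζ := IsCyclotomicExtension.zeta m ℚ (CyclotomicField m ℚ) with hζdef
  set pb : PowerBasis ℚ (CyclotomicField m ℚ) := IsPrimitiveRoot.powerBasis ℚ hζ with hpb
  have hgen : pb.gen = ζ := IsPrimitiveRoot.powerBasis_gen ℚ hζ
  set d : Module.Basis (Fin pb.dim) ℚ (CyclotomicField m ℚ) := pb.basis.traceDual with hd
  set f : Module.Basis (Fin pb.dim) ℚ_[p] (ℚ_[p] ⊗[ℚ] CyclotomicField m ℚ) :=
    Algebra.TensorProduct.basis ℚ_[p] d with hf
  have htr : ∀ i j : Fin pb.dim,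
      Algebra.trace ℚ_[p] (ℚ_[p] ⊗[ℚ] CyclotomicField m ℚ) (f j * ((1 : ℚ_[p]) ⊗ₜ[ℚ] (ζ ^ (i : ℕ)))) =
        if i = j then 1 else 0 := by
    intro i j
    rw [hf, Algebra.TensorProduct.basis_apply, Algebra.TensorProduct.tmul_mul_tmul, one_mul,
      trace_one_tmul, hd]
    have hb : ζ ^ (i : ℕ) = pb.basis i := by rw [pb.coe_basis, hgen]
    rw [hb, Module.Basis.trace_traceDual_mul]
    split_ifs <;> simp
  have hcoord : ∀ i : Fin pb.dim, f.repr a i =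
      Algebra.trace ℚ_[p] (ℚ_[p] ⊗[ℚ] CyclotomicField m ℚ) (a * ((1 : ℚ_[p]) ⊗ₜ[ℚ] (ζ ^ (i : ℕ)))) := by
    intro i
    conv_rhs => rw [← f.sum_repr a]
    rw [Finset.sum_mul, map_sum]
    simp_rw [smul_mul_assoc, map_smul, htr, smul_eq_mul, mul_ite, mul_one, mul_zero]
    rw [Finset.sum_ite_eq]
    simp
  have hmf : ∀ i : Fin pb.dim, (m : ℚ_[p]) • f i ∈ cycIntLattice p m := by
    intro i
    obtain ⟨z, hz, hzeq⟩ := exists_natCast_mul_traceDual_eq m hζ i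
    have h1z := one_tmul_mem_cycIntLattice_of_mem_adjoin m p hz
    have hdi : d i = (IsPrimitiveRoot.powerBasis ℚ hζ).basis.traceDual i := rfl
    have heq : (m : ℚ_[p]) • f i = (1 : ℚ_[p]) ⊗ₜ[ℚ] z := by
      rw [hf, Algebra.TensorProduct.basis_apply, ← hzeq, ← hdi,
        show (m : ℚ_[p]) = algebraMap ℚ ℚ_[p] (m : ℚ) by simp, IsScalarTower.algebraMap_smul,
        ← TensorProduct.tmul_smul, Algebra.smul_def, map_natCast]
    rw [heq]
    exact h1z
  rw [← f.sum_repr a, Finset.smul_sum]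
  refine Submodule.sum_mem _ fun i _ => ?_
  rw [smul_comm]
  obtain ⟨r, hr⟩ := exists_padicInt_coe_eq_of_norm_le_one (p := p) (x := f.repr a i) (by
    rw [hcoord]; exact ha i)
  rw [← hr, ← padicInt_smul_eq_coe_smul]
  exact Submodule.smul_mem _ r (hmf i)

/-- ★★ **Self-duality in the rider's currency, `p ∤ m`**: `a ∈ ℚ_p ⊗ ℚ(ζ_m)` with
`‖Tr(a·(1 ⊗ ζ_m^j))‖ ≤ 1` for all `j` lies in `cycIntLattice p m = ℤ_p⟨1 ⊗ ζ_m^j⟩` — the lattice of the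
rider clause (ii) / (X1-int_b) of the W2 consumers (`KatoExpStarFiniteLevelAt`, (C1ₑₓ)).  With
`KimAtThreePortSharedSATCore.norm_trace_le_one_of_mem_cycIntLattice` (the "`⊆`" half):
`(cycIntLattice p m)^∨ = cycIntLattice p m`.
[cite: Kim2022StructureSelmer, §3.4.1 and the proof of Thm. 3.13 (arXiv v3 pp. 26–27)] -/
theorem mem_cycIntLattice_of_norm_trace_mul_zeta_pow_le_one (hpm : ¬ p ∣ m)
    {a : ℚ_[p] ⊗[ℚ] CyclotomicField m ℚ}
    (ha : ∀ j : ℕ, ‖Algebra.trace ℚ_[p] (ℚ_[p] ⊗[ℚ] CyclotomicField m ℚ)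
        (a * ((1 : ℚ_[p]) ⊗ₜ[ℚ] (IsCyclotomicExtension.zeta m ℚ (CyclotomicField m ℚ) ^ j)))‖ ≤ 1) :
    a ∈ cycIntLattice p m := by
  have hma := natCast_smul_mem_cycIntLattice_of_norm_trace_mul_zeta_pow_le_one m p ha
  have hnorm : ‖((m : ℤ) : ℤ_[p])‖ = 1 := by
    refine le_antisymm (PadicInt.norm_le_one _) (not_lt.mp fun hlt => hpm ?_)
    have := (PadicInt.norm_int_lt_one_iff_dvd (p := p) (m : ℤ)).mp hlt
    exact_mod_cast this
  obtain ⟨u, hu⟩ := PadicInt.isUnit_iff.mpr hnorm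
  have hma' : (u : ℤ_[p]) • a ∈ cycIntLattice p m := by
    rw [hu, padicInt_smul_eq_coe_smul]
    simpa using hma
  have := Submodule.smul_mem _ (↑u⁻¹ : ℤ_[p]) hma'
  rwa [smul_smul, Units.inv_mul, one_smul] at this

/-- **`cycIntLattice p m = L_int′(m)` for `p ∤ m`**: seat w2-acc4's INTO inclusion
`KimAtThreeFineKatoSemiLocalLattice.cycIntLattice_le_span_ringOfIntegers` (any `m`) is an EQUALITY at
primes not dividing the level — WITHOUT the global `𝓞_{ℚ(ζ_m)} = ℤ[ζ_m]` (in Mathlib for prime powers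
only): an element of `ℤ_p⟨1 ⊗ 𝓞⟩` has integral traces against the `1 ⊗ ζ^j` (w2-acc4), hence ★★.  So the
two semi-local integer lattices of the W2 files coincide and both equal `Ψ⁻¹(∏_w 𝒪_w)`.
[cite: Kim2022StructureSelmer, §3.4.1 (the lattice `ℤ_p ⊗ ℤ[ζ_n]` in the proof of Thm. 3.13)] -/
theorem cycIntLattice_eq_span_ringOfIntegers (hpm : ¬ p ∣ m) :
    cycIntLattice p m = Submodule.span ℤ_[p]
      (Set.range fun b : 𝓞 (CyclotomicField m ℚ) ↦ (1 : ℚ_[p]) ⊗ₜ[ℚ] (b : CyclotomicField m ℚ)) := by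
  refine le_antisymm (KimAtThreeFineKatoSemiLocalLattice.cycIntLattice_le_span_ringOfIntegers p m)
    fun a ha => ?_
  refine mem_cycIntLattice_of_norm_trace_mul_zeta_pow_le_one m p hpm fun j => ?_
  refine KimAtThreeFineKatoSemiLocalLatticeInt.norm_trace_le_one_of_mem_span_ringOfIntegers p m
    (KimAtThreeFineKatoSemiLocalLatticeInt.mul_mem_span_ringOfIntegers p m ha ?_)
  have hint : IsIntegral ℤ (IsCyclotomicExtension.zeta m ℚ (CyclotomicField m ℚ) ^ j) :=
    ((IsCyclotomicExtension.zeta_spec m ℚ (CyclotomicField m ℚ)).isIntegral (NeZero.pos m)).pow j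
  exact Submodule.subset_span ⟨⟨_, (mem_integralClosure_iff ℤ (CyclotomicField m ℚ)).mpr hint⟩, rfl⟩

/-- **`(cycIntLattice p m)^∨ = cycIntLattice p m` (`p ∤ m`)**, as an `iff` on elements.
[cite: Kim2022StructureSelmer, §3.4.1 and the proof of Thm. 3.13 (arXiv v3 pp. 26–27)] -/
theorem mem_cycIntLattice_iff_forall_norm_trace_mul_le_one (hpm : ¬ p ∣ m)
    (a : ℚ_[p] ⊗[ℚ] CyclotomicField m ℚ) :
    a ∈ cycIntLattice p m ↔ ∀ l ∈ cycIntLattice p m,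
      ‖Algebra.trace ℚ_[p] (ℚ_[p] ⊗[ℚ] CyclotomicField m ℚ) (a * l)‖ ≤ 1 := by
  constructor
  · intro ha l hl
    exact norm_trace_le_one_of_mem_cycIntLattice p m (mul_mem_cycIntLattice p m ha hl)
  · intro h
    refine mem_cycIntLattice_of_norm_trace_mul_zeta_pow_le_one m p hpm fun j => h _ ?_
    have hgen : ((1 : ℚ_[p]) ⊗ₜ[ℚ] IsCyclotomicExtension.zeta m ℚ (CyclotomicField m ℚ)) ^ j ∈
        cycIntLattice p m :=
      Submodule.subset_span (Set.mem_range_self j)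
    rwa [Algebra.TensorProduct.tmul_pow, one_pow] at hgen

/-- **Per-factor form in the rider's currency**: along w2-acc4's `Ψ`, a family `(y_w)_{w ∣ p}` with each `y_w`
in the trace dual of `𝒪_w` has `Ψ⁻¹ y ∈ cycIntLattice p m` (`p ∤ m`) — §4 and `cycIntLattice = L_int′`.
[cite: CasselsFrohlichANT1967, Ch. II §10 Theorem (10.2) and §11] -/
theorem symm_mem_cycIntLattice_of_forall_trace_mul_mem (hpm : ¬ p ∣ m)
    [Fintype (((Rat.HeightOneSpectrum.primesEquiv (R := 𝓞 ℚ)).symm ⟨p, Fact.out⟩).Extension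
      (𝓞 (CyclotomicField m ℚ)))]
    (Ψ : ℚ_[p] ⊗[ℚ] CyclotomicField m ℚ ≃ₐ[ℚ]
      (Π w : ((Rat.HeightOneSpectrum.primesEquiv (R := 𝓞 ℚ)).symm ⟨p, Fact.out⟩).Extension
        (𝓞 (CyclotomicField m ℚ)), w.1.adicCompletion (CyclotomicField m ℚ)))
    (hΨ : ∀ (s : ℚ_[p]) (x : CyclotomicField m ℚ)
      (w : ((Rat.HeightOneSpectrum.primesEquiv (R := 𝓞 ℚ)).symm ⟨p, Fact.out⟩).Extension
        (𝓞 (CyclotomicField m ℚ))),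
      Ψ (s ⊗ₜ[ℚ] x) w = algebraMap (CyclotomicField m ℚ) (w.1.adicCompletion (CyclotomicField m ℚ)) x *
        algebraMap (((Rat.HeightOneSpectrum.primesEquiv (R := 𝓞 ℚ)).symm ⟨p, Fact.out⟩).adicCompletion ℚ)
          (w.1.adicCompletion (CyclotomicField m ℚ)) (Padic.adicCompletionEquiv (𝓞 ℚ) ⟨p, Fact.out⟩ s))
    (y : Π w : ((Rat.HeightOneSpectrum.primesEquiv (R := 𝓞 ℚ)).symm ⟨p, Fact.out⟩).Extension
        (𝓞 (CyclotomicField m ℚ)), w.1.adicCompletion (CyclotomicField m ℚ))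
    (hy : ∀ w, ∀ o ∈ w.1.adicCompletionIntegers (CyclotomicField m ℚ),
      Algebra.trace (((Rat.HeightOneSpectrum.primesEquiv (R := 𝓞 ℚ)).symm ⟨p, Fact.out⟩).adicCompletion ℚ)
          (w.1.adicCompletion (CyclotomicField m ℚ)) (y w * o) ∈
        (((Rat.HeightOneSpectrum.primesEquiv (R := 𝓞 ℚ)).symm ⟨p, Fact.out⟩).adicCompletionIntegers ℚ)) :
    Ψ.symm y ∈ cycIntLattice p m := by
  rw [cycIntLattice_eq_span_ringOfIntegers m p hpm]
  exact symm_mem_span_ringOfIntegers_of_forall_trace_mul_mem m p hpm Ψ hΨ y hy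

/-! ### (LAT₁) — the uniform road's lattice clause from per-factor duality data -/

/-- **(LAT₁) from per-factor duality data.**  For w2-acc4's `Ψ` (`p ∤ m`), per-factor "log-lattices"
`Λ₀ʷ ⊆ L_w` containing `p·𝒪_w` (the K-port's `log_ω(E₁(L_w)) = p𝒪_w ⊆ log_ω(E(L_w))`) and per-factor maps
`φ_w : H_w → L_w` (intended: `exp*_ω` on `H¹(L_w, T)`) whose values pair `p`-integrally with `Λ₀ʷ` under
`Tr_{L_w/ℚ_v}` (the cite fact (S5b) = [BK90] 3.8 + local Tate duality at `K = L_w`, `⊆`-direction), the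
CRUDE bound holds in the consumers' lattice: `p · Ψ⁻¹((φ_w(z_w))_w) ∈ cycIntLattice p m` for every family
`z` — i.e. acc5's (LAT) / w2-c3's (LAT_b) with `b = 1`, `ι_w = Ψ⁻¹ ∘ (w-th coordinate)`, `M = M₁`.  Pure
algebra on top of ★★ (§4/§5 of this seat's files); nothing about curves is used or asserted.
[cite: Kim2022StructureSelmer, §3.4.1 and the proof of Thm. 3.13 (arXiv v3 pp. 26–27)]
[cite: BlochKato1990, Prop. 3.8] -/
theorem prime_smul_symm_mem_cycIntLattice_of_pairing (hpm : ¬ p ∣ m)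
    [Fintype (((Rat.HeightOneSpectrum.primesEquiv (R := 𝓞 ℚ)).symm ⟨p, Fact.out⟩).Extension
      (𝓞 (CyclotomicField m ℚ)))]
    (Ψ : ℚ_[p] ⊗[ℚ] CyclotomicField m ℚ ≃ₐ[ℚ]
      (Π w : ((Rat.HeightOneSpectrum.primesEquiv (R := 𝓞 ℚ)).symm ⟨p, Fact.out⟩).Extension
        (𝓞 (CyclotomicField m ℚ)), w.1.adicCompletion (CyclotomicField m ℚ)))
    (hΨ : ∀ (s : ℚ_[p]) (x : CyclotomicField m ℚ)
      (w : ((Rat.HeightOneSpectrum.primesEquiv (R := 𝓞 ℚ)).symm ⟨p, Fact.out⟩).Extension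
        (𝓞 (CyclotomicField m ℚ))),
      Ψ (s ⊗ₜ[ℚ] x) w = algebraMap (CyclotomicField m ℚ) (w.1.adicCompletion (CyclotomicField m ℚ)) x *
        algebraMap (((Rat.HeightOneSpectrum.primesEquiv (R := 𝓞 ℚ)).symm ⟨p, Fact.out⟩).adicCompletion ℚ)
          (w.1.adicCompletion (CyclotomicField m ℚ)) (Padic.adicCompletionEquiv (𝓞 ℚ) ⟨p, Fact.out⟩ s))
    {H : ((Rat.HeightOneSpectrum.primesEquiv (R := 𝓞 ℚ)).symm ⟨p, Fact.out⟩).Extension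
        (𝓞 (CyclotomicField m ℚ)) → Type*}
    (φ : ∀ w, H w → w.1.adicCompletion (CyclotomicField m ℚ))
    (Λ₀ : ∀ w : ((Rat.HeightOneSpectrum.primesEquiv (R := 𝓞 ℚ)).symm ⟨p, Fact.out⟩).Extension
        (𝓞 (CyclotomicField m ℚ)), Set (w.1.adicCompletion (CyclotomicField m ℚ)))
    (hΛ₀ : ∀ w, ∀ o ∈ w.1.adicCompletionIntegers (CyclotomicField m ℚ),
      (p : w.1.adicCompletion (CyclotomicField m ℚ)) * o ∈ Λ₀ w)
    (hpair : ∀ w (x : H w), ∀ l ∈ Λ₀ w,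
      Algebra.trace (((Rat.HeightOneSpectrum.primesEquiv (R := 𝓞 ℚ)).symm ⟨p, Fact.out⟩).adicCompletion ℚ)
          (w.1.adicCompletion (CyclotomicField m ℚ)) (φ w x * l) ∈
        (((Rat.HeightOneSpectrum.primesEquiv (R := 𝓞 ℚ)).symm ⟨p, Fact.out⟩).adicCompletionIntegers ℚ))
    (z : ∀ w, H w) :
    ((p : ℕ) : ℤ_[p]) • Ψ.symm (fun w => φ w (z w)) ∈ cycIntLattice p m := by
  have hsmul : ((p : ℕ) : ℤ_[p]) • Ψ.symm (fun w => φ w (z w)) =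
      Ψ.symm (fun w => (p : w.1.adicCompletion (CyclotomicField m ℚ)) * φ w (z w)) := by
    rw [Nat.cast_smul_eq_nsmul, ← map_nsmul]
    congr 1
    funext w
    rw [Pi.smul_apply, nsmul_eq_mul]
  rw [hsmul]
  refine symm_mem_cycIntLattice_of_forall_trace_mul_mem m p hpm Ψ hΨ _ fun w o ho => ?_
  rw [mul_comm (p : w.1.adicCompletion (CyclotomicField m ℚ)), mul_assoc]
  exact hpair w (z w) _ (hΛ₀ w o ho)

/-- **(LAT₁), `L_int′(m)` form** (any consumer keyed on `ℤ_p⟨1 ⊗ 𝓞⟩`). [cite: Kim2022StructureSelmer, §3.4.1] -/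
theorem prime_smul_symm_mem_span_ringOfIntegers_of_pairing (hpm : ¬ p ∣ m)
    [Fintype (((Rat.HeightOneSpectrum.primesEquiv (R := 𝓞 ℚ)).symm ⟨p, Fact.out⟩).Extension
      (𝓞 (CyclotomicField m ℚ)))]
    (Ψ : ℚ_[p] ⊗[ℚ] CyclotomicField m ℚ ≃ₐ[ℚ]
      (Π w : ((Rat.HeightOneSpectrum.primesEquiv (R := 𝓞 ℚ)).symm ⟨p, Fact.out⟩).Extension
        (𝓞 (CyclotomicField m ℚ)), w.1.adicCompletion (CyclotomicField m ℚ)))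
    (hΨ : ∀ (s : ℚ_[p]) (x : CyclotomicField m ℚ)
      (w : ((Rat.HeightOneSpectrum.primesEquiv (R := 𝓞 ℚ)).symm ⟨p, Fact.out⟩).Extension
        (𝓞 (CyclotomicField m ℚ))),
      Ψ (s ⊗ₜ[ℚ] x) w = algebraMap (CyclotomicField m ℚ) (w.1.adicCompletion (CyclotomicField m ℚ)) x *
        algebraMap (((Rat.HeightOneSpectrum.primesEquiv (R := 𝓞 ℚ)).symm ⟨p, Fact.out⟩).adicCompletion ℚ)
          (w.1.adicCompletion (CyclotomicField m ℚ)) (Padic.adicCompletionEquiv (𝓞 ℚ) ⟨p, Fact.out⟩ s))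
    {H : ((Rat.HeightOneSpectrum.primesEquiv (R := 𝓞 ℚ)).symm ⟨p, Fact.out⟩).Extension
        (𝓞 (CyclotomicField m ℚ)) → Type*}
    (φ : ∀ w, H w → w.1.adicCompletion (CyclotomicField m ℚ))
    (Λ₀ : ∀ w : ((Rat.HeightOneSpectrum.primesEquiv (R := 𝓞 ℚ)).symm ⟨p, Fact.out⟩).Extension
        (𝓞 (CyclotomicField m ℚ)), Set (w.1.adicCompletion (CyclotomicField m ℚ)))
    (hΛ₀ : ∀ w, ∀ o ∈ w.1.adicCompletionIntegers (CyclotomicField m ℚ),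
      (p : w.1.adicCompletion (CyclotomicField m ℚ)) * o ∈ Λ₀ w)
    (hpair : ∀ w (x : H w), ∀ l ∈ Λ₀ w,
      Algebra.trace (((Rat.HeightOneSpectrum.primesEquiv (R := 𝓞 ℚ)).symm ⟨p, Fact.out⟩).adicCompletion ℚ)
          (w.1.adicCompletion (CyclotomicField m ℚ)) (φ w x * l) ∈
        (((Rat.HeightOneSpectrum.primesEquiv (R := 𝓞 ℚ)).symm ⟨p, Fact.out⟩).adicCompletionIntegers ℚ))
    (z : ∀ w, H w) :
    ((p : ℕ) : ℤ_[p]) • Ψ.symm (fun w => φ w (z w)) ∈ Submodule.span ℤ_[p]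
      (Set.range fun b : 𝓞 (CyclotomicField m ℚ) ↦ (1 : ℚ_[p]) ⊗ₜ[ℚ] (b : CyclotomicField m ℚ)) := by
  rw [← cycIntLattice_eq_span_ringOfIntegers m p hpm]
  exact prime_smul_symm_mem_cycIntLattice_of_pairing m p hpm Ψ hΨ φ Λ₀ hΛ₀ hpair z

end Summit.BirchSwinnertonDyer.BirchSwinnertonDyer.Theorems.KimAtThreeSemiLocalTraceDualCyc

end
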